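import Literature.Probability.Percolation.ArmSeparationOutRouteFour
import Literature.Probability.Percolation.ArmSeparationInSepFour
import HarnessLib

/-!
# Routing the four corridors of the inner landing: from the order certificate to a routed slot

Topic `Literature/Probability/Percolation`; family `crit-perc` / near-critical percolation on `𝕋`.
A brick of the near-critical arm-separation theorem for four arms of alternating colours
(P. Nolin, *Near-critical percolation in two dimensions*, EJP 13 (2008), Thm. 11 for `j = 4`,
`σ = BWBW` [arXiv 0711.4948: Thm. 10], landing step of the INTERNAL extremities, §4.4 p. 13 with
Prop. 12 (i)): the inner twin of `ArmSeparationOutRouteFour.lean`. From the *tip data* of a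
configuration of `IntTinyExt4` — frames, scales, windows and rows of the four fenced inner tips, in
the anticlockwise order of `∂Λ_m` (the order certificate of `ArmSeparationIntSurgeryFour.lean`), with
the row gaps of fenced tips on a common frame — and target rows off the tips' danger zones
(`exists_tgt`), this file builds a slot `ITipData.slot` of `ArmSeparationInSlotsFour` and proves its
routing predicate `InSlot4.RouteOK` (`ITipData.routeOK_slot`). The keys of tips and targets are the
perimeter keys `frKey Mstar` of `ArmSeparationOutKeysFour` for the fictitious half-radius
`Mstar = ⌊irL 7 / 2⌋` of the innermost ring road (every object's rows are interior rows of the sides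
of `∂Λ_{2 Mstar}` since the tips are `R₀ ≥ 16 μ` away from the corners, and every ring lies outside
`Λ_{2 Mstar}`), so that the key machinery, the cut (`Lanes.exists_cut'`), the levels
(`Lanes.laneLevel`, `Lanes.lanes_linear`) and the window order (`RingObj.linPos_lt_of_cyc_lt`) apply
verbatim. The tip data use the carrier `TipData` of the outer twin (`ITipData := TipData`) and its
routing certificate `TipData.Route`; only the readings (`ITipData.T`, `k`, `ξ`, `κ`, …, `RouteGood`)
are specific to the inner rung. The rung predicate `LParams.RValid` strengthens `LParams.Valid` by
`16 μ ≤ R₀` (the standard witness `rungParams` has `R₀ = 8 μ` and does NOT satisfy it; the assembler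
uses a rung with the larger margin, e.g. `R₀ = 16 μ`, `64 μ ≤ n / D`). Everything here is proved; no
named facts are introduced.

## References

* P. Nolin, Near-critical percolation in two dimensions, *Electron. J. Probab.* 13 (2008), §4.3
  Prop. 12 (i), Lemma 13, §4.4 (arXiv 0711.4948: Prop. 11, Lemma 12; proof of Thm. 10, p. 13) [Nolin2008].
* H. Kesten, Scaling relations for 2D-percolation, *Comm. Math. Phys.* 109 (1987), Lemmas 4–6 [Kesten1987].
-/

namespace Literature.Probability.Percolation

open Lanes

/-! ### The fictitious half-radius and the strengthened validity -/

namespace LParams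

/-- **The fictitious half-radius**: half the radius of the innermost ring road, rounded down. [folklore] -/
def Mstar (P : LParams) : ℕ := P.irL 7 / 2

/-- **Validity of a rung of the four-arm inner landing**: a valid rung with at least one fence scale
and tips at least `16 μ` from the corners. [folklore] -/
structure RValid (P : LParams) : Prop where
  /-- the rung is valid -/
  toValid : P.Valid
  /-- at least one scale -/
  hK : 1 ≤ P.K
  /-- tip margin -/
  hR16 : 16 * P.μ ≤ P.R₀

variable {P : LParams}

/-- **The numeric facts of a valid rung of the inner landing**, cast to `ℤ` (layout as
`OParams.Valid.ifacts`). [folklore] -/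
theorem RValid.rfacts (hV : P.RValid) :
    (P.s : ℤ) = P.k₀ ∧ 64 ≤ (P.k₀ : ℤ) ∧ 32 * (P.k₀ : ℤ) ≤ P.μ ∧ 4 * (P.w : ℤ) ≤ P.k₀ ∧ (P.k₀ : ℤ) ≤ 4 * P.w + 3 ∧
      4 * (P.e : ℤ) ≤ P.k₀ ∧ (P.k₀ : ℤ) ≤ 4 * P.e + 3 ∧ 16 * (P.ε : ℤ) ≤ P.k₀ ∧ (P.k₀ : ℤ) ≤ 16 * P.ε + 15 ∧
      2 * (P.Mstar : ℤ) ≤ P.irL 7 ∧ (P.irL 7 : ℤ) ≤ 2 * P.Mstar + 1 ∧ (P.irL 7 : ℤ) ≤ P.m - 15 * P.μ ∧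
      (P.m : ℤ) - 15 * P.μ < P.irL 7 + P.s ∧ (P.n : ℤ) + P.s + 2 * P.e ≤ P.irL 7 ∧ (P.irL 7 : ℤ) + 2 * P.e ≤ P.m ∧
      (P.m : ℤ) = 2 * P.n + 1 ∧ 2 * (P.m : ℤ) ≤ P.N ∧ 128 ≤ (P.n : ℤ) ∧ 16 * (P.μ : ℤ) ≤ P.R₀ ∧ 64 * (P.μ : ℤ) ≤ P.n ∧
      8 * (P.μ : ℤ) ≤ P.R₀ ∧ 4 * (P.R₀ : ℤ) ≤ P.n ∧ (P.iLL 7 : ℤ) = 15 * P.μ + 2 * P.s + 4 * P.e ∧ 1 ≤ P.K := by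
  obtain ⟨hs, hw, he, hε, hk₀, hkμ, -, -, -, -, -, -, hm, hN, hn, hμn, hR₀, hR₀n⟩ := hV.toValid.facts
  obtain ⟨r1, r2, -, -, r5, r6, r7⟩ := hV.toValid.iring_ifacts (show 7 < 8 by norm_num)
  have h32 : 32 * P.k₀ ≤ P.μ := by have := P.scale_le hV.hK; unfold trapScale at this; simpa using this
  have hM1 : 2 * (P.Mstar : ℤ) ≤ P.irL 7 := by unfold LParams.Mstar; omega
  have hM2 : (P.irL 7 : ℤ) ≤ 2 * P.Mstar + 1 := by unfold LParams.Mstar; omega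
  refine ⟨by rw [hs], by exact_mod_cast hk₀, by exact_mod_cast h32, by rw [hw]; omega, by rw [hw]; omega, by rw [he]; omega,
    by rw [he]; omega, by rw [hε]; omega, by rw [hε]; omega, hM1, hM2, by push_cast at r1; linarith, by push_cast at r2; linarith,
    r5, r6, by exact_mod_cast hm, by exact_mod_cast hN, by exact_mod_cast hn, by exact_mod_cast hV.hR16, by exact_mod_cast hμn,
    by exact_mod_cast hR₀, by exact_mod_cast hR₀n, r7, hV.hK⟩

end LParams

/-! ### Tip data -/

/-- **The tip data of a configuration of `IntTinyExt4`** (the inner half): the same carrier as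
`TipData` (`ArmSeparationOutRouteFour`) — for the four fenced tips in the anticlockwise order of `∂Λ_m`
given by the order certificate of `ArmSeparationIntSurgeryFour` (colours open, closed, open, closed for
`a = 0, 1, 2, 3`): the frame `i a`, the scale index `j a`, the window index `ν a` and the tip row `ζ a`
— read below through the inner rung `LParams` (windows `T₀`, perimeter `12 M⋆`, inward target rows)
instead of `OParams`. [folklore] -/
def ITipData : Type := TipData

namespace ITipData

variable (P : LParams) (D : ITipData) (tc : Fin 4 → ℕ)

/-- window start of the tip `a` [folklore] -/
def T (a : Fin 4) : ℤ := P.T₀ (D.ν a)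
/-- scale of the tip `a` [folklore] -/
def k (a : Fin 4) : ℕ := trapScale P.k₀ (D.j a)
/-- spoke row of the tip `a` [folklore] -/
def ξ (a : Fin 4) : ℤ := D.T P a + 2 * D.k P a + P.w
/-- spoke key of the tip `a` [folklore] -/
def κ (a : Fin 4) : ℤ := frKey P.Mstar (D.i a) (D.ξ P a)
/-- tip key of the tip `a` (the perimeter coordinate of the framed tip) [folklore] -/
def κz (a : Fin 4) : ℤ := frKey P.Mstar (D.i a) (D.ζ a)
/-- target row of the landing side `e` (sides `0, 2, 3, 5` for `e = 0, 1, 2, 3`) for the choices `tc` [folklore] -/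
def t (e : Fin 4) : ℤ := P.itgtRow4 (tc e)
/-- target key of the landing side `e` [folklore] -/
def γ (e : Fin 4) : ℤ := frKey P.Mstar (Slot4.ts e) (t P tc e)

/-- **Good inner tip data** (what `IntTinyExt4` provides on `∂Λ_m`, besides the order certificate of
`ArmSeparationIntSurgeryFour`): ranges, the tip row
in its window and in the middle of its side, the row gap of fenced tips of different colours on a common
frame (`row_gap_of_lt`), and for two tips of the same colour on a common frame a tip of the other colour on
that frame strictly between them (the order certificate read through `frame_eq_and_row_sbtw`). [folklore] -/
structure Good : Prop where
  /-- frames -/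
  hi : ∀ a, D.i a < 6
  /-- scale indices -/
  hj : ∀ a, D.j a < P.K
  /-- windows -/
  hν : ∀ a, D.ν a < P.Nw
  /-- the tip row lies in its window -/
  hζ : ∀ a, D.T P a ≤ D.ζ a ∧ D.ζ a < D.T P a + P.w
  /-- middle tips -/
  hgood : ∀ a, -(P.m : ℤ) + P.R₀ ≤ D.ζ a ∧ D.ζ a ≤ -(P.R₀ : ℤ)
  /-- different colours on a common frame: row gap -/
  hdiff : ∀ a b : Fin 4, (a : ℕ) % 2 ≠ (b : ℕ) % 2 → D.i a = D.i b → D.ζ a + 8 * D.k P a < D.ζ b ∨ D.ζ b + 8 * D.k P b < D.ζ a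
  /-- open tips on a common frame: a closed tip between -/
  hsame02 : D.i 0 = D.i 2 → ∃ c : Fin 4, (c : ℕ) % 2 = 1 ∧ D.i c = D.i 0 ∧ SBtw (D.ζ 0) (D.ζ c) (D.ζ 2)
  /-- closed tips on a common frame: an open tip between -/
  hsame13 : D.i 1 = D.i 3 → ∃ c : Fin 4, (c : ℕ) % 2 = 0 ∧ D.i c = D.i 1 ∧ SBtw (D.ζ 1) (D.ζ c) (D.ζ 3)

/-- **Targets off the danger zones**: the target row of the side `e` is more than `μ + 8s` below, or its
approach rows end more than `μ + 8s` below, the spoke row of every tip of the frame `ts e`. [folklore] -/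
structure TgtOK : Prop where
  /-- every tip of the landing side is off the danger zone of the target -/
  out : ∀ e a, D.i a = Slot4.ts e → D.ξ P a + P.μ + 8 * P.s < t P tc e ∨ t P tc e + (P.n / 64 : ℕ) + P.μ + 8 * P.s < D.ξ P a

variable {P D tc}

/-- **Numeric facts of good tip data** in a valid rung. [folklore] -/
theorem Good.facts (hV : P.RValid) (hD : D.Good P) (a : Fin 4) :
    (P.k₀ : ℤ) ≤ D.k P a ∧ 32 * (D.k P a : ℤ) ≤ P.μ ∧ D.ξ P a = D.T P a + 2 * D.k P a + P.w ∧
      D.T P a ≤ D.ζ a ∧ D.ζ a < D.T P a + P.w ∧ -(P.m : ℤ) + P.R₀ ≤ D.ζ a ∧ D.ζ a ≤ -(P.R₀ : ℤ) ∧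
      -(2 * (P.Mstar : ℤ)) + 7 * P.s ≤ D.ξ P a ∧ D.ξ P a + 7 * P.s < 0 ∧ -(2 * (P.Mstar : ℤ)) < D.ζ a ∧ D.ζ a < 0 := by
  obtain ⟨hs, hk₀, hμ, hw1, hw2, -, -, -, -, hM1, hM2, hr1, hr2, -, -, -, -, -, hR16, hμM, hR₀, hR₀M, -, -⟩ := hV.rfacts
  have hk1 : (P.k₀ : ℤ) ≤ D.k P a := by exact_mod_cast le_trapScale P.k₀ (D.j a)
  have hk2 : 32 * (D.k P a : ℤ) ≤ P.μ := by exact_mod_cast P.scale_le (hD.hj a)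
  obtain ⟨z1, z2⟩ := hD.hζ a
  obtain ⟨g1, g2⟩ := hD.hgood a
  have hξ : D.ξ P a = D.T P a + 2 * D.k P a + P.w := rfl
  refine ⟨hk1, hk2, hξ, z1, z2, g1, g2, ?_, ?_, ?_, ?_⟩ <;> omega

/-- **Row gap of tips of different colours on a common frame**, in the three forms used: the spoke rows
differ by more than seven chunks, and the windows are as far apart as `RouteOK` (h) demands. [folklore] -/
theorem Good.gap_of_diff (hV : P.RValid) (hD : D.Good P) {a b : Fin 4} (hpar : (a : ℕ) % 2 ≠ (b : ℕ) % 2)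
    (hi : D.i a = D.i b) (hlt : D.ζ a < D.ζ b) :
    D.ξ P a + 7 * P.s < D.ξ P b ∧ D.T P a + 8 * D.k P a < D.T P b + P.w := by
  obtain ⟨ka1, -, hξa, za1, za2, -⟩ := hD.facts hV a
  obtain ⟨kb1, -, hξb, zb1, zb2, -⟩ := hD.facts hV b
  obtain ⟨hs, hk₀, -, hw1, -⟩ := hV.rfacts
  have hk0 : (0 : ℤ) ≤ D.k P b := by positivity
  rcases hD.hdiff a b hpar hi with h | h
  · constructor <;> nlinarith
  · nlinarith

/-- **Two distinct tips on a common frame, the first below the second: the spoke rows differ by more than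
seven chunks** (different colours: the row gap; the same colour: through the tip between). [folklore] -/
theorem Good.gap (hV : P.RValid) (hD : D.Good P) {a b : Fin 4} (hab : a ≠ b) (hi : D.i a = D.i b) (hlt : D.ζ a < D.ζ b) :
    D.ξ P a + 7 * P.s < D.ξ P b := by
  by_cases hpar : (a : ℕ) % 2 ≠ (b : ℕ) % 2
  · exact (hD.gap_of_diff hV hpar hi hlt).1
  · push Not at hpar
    have hs0 : (0 : ℤ) ≤ P.s := by positivity
    -- same colour: `{a, b} = {0, 2}` or `{1, 3}`
    have key : ∀ {x y : Fin 4} (c : Fin 4), (c : ℕ) % 2 ≠ (x : ℕ) % 2 → (x : ℕ) % 2 = (y : ℕ) % 2 → D.i c = D.i x →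
        D.i x = D.i y → SBtw (D.ζ x) (D.ζ c) (D.ζ y) → D.ζ x < D.ζ y → D.ξ P x + 7 * P.s < D.ξ P y := by
      intro x y c hcx hxy hic hixy hb hxy'
      rcases hb with ⟨b1, b2⟩ | ⟨b1, b2⟩
      · have g1 := (hD.gap_of_diff hV (Ne.symm hcx) hic.symm b1).1
        have g2 := (hD.gap_of_diff hV (by omega) (hic.trans hixy) b2).1
        linarith
      · exfalso; linarith
    have ha := a.isLt; have hb := b.isLt
    have hab' : (a : ℕ) ≠ b := fun h => hab (Fin.ext h)
    have h4 : ((a : ℕ) = 0 ∧ (b : ℕ) = 2) ∨ ((a : ℕ) = 2 ∧ (b : ℕ) = 0) ∨ ((a : ℕ) = 1 ∧ (b : ℕ) = 3) ∨ ((a : ℕ) = 3 ∧ (b : ℕ) = 1) := by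
      omega
    rcases h4 with ⟨ha0, hb0⟩ | ⟨ha0, hb0⟩ | ⟨ha0, hb0⟩ | ⟨ha0, hb0⟩
    · have ea : a = 0 := Fin.ext ha0; have eb : b = 2 := Fin.ext hb0
      subst ea; subst eb
      obtain ⟨c, hc1, hc2, hc3⟩ := hD.hsame02 hi
      exact key c (by simp [hc1]) (by decide) hc2 hi hc3 hlt
    · have ea : a = 2 := Fin.ext ha0; have eb : b = 0 := Fin.ext hb0
      subst ea; subst eb
      obtain ⟨c, hc1, hc2, hc3⟩ := hD.hsame02 hi.symm
      refine key c (by simp [hc1]) (by decide) (hc2.trans hi.symm) hi ?_ hlt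
      unfold SBtw at hc3 ⊢; tauto
    · have ea : a = 1 := Fin.ext ha0; have eb : b = 3 := Fin.ext hb0
      subst ea; subst eb
      obtain ⟨c, hc1, hc2, hc3⟩ := hD.hsame13 hi
      exact key c (by simp [hc1]) (by decide) hc2 hi hc3 hlt
    · have ea : a = 3 := Fin.ext ha0; have eb : b = 1 := Fin.ext hb0
      subst ea; subst eb
      obtain ⟨c, hc1, hc2, hc3⟩ := hD.hsame13 hi.symm
      refine key c (by simp [hc1]) (by decide) (hc2.trans hi.symm) hi ?_ hlt
      unfold SBtw at hc3 ⊢; tauto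

/-- **Distinct tips on a common frame have distinct rows.** [folklore] -/
theorem Good.zeta_ne (hV : P.RValid) (hD : D.Good P) {a b : Fin 4} (hab : a ≠ b) (hi : D.i a = D.i b) : D.ζ a ≠ D.ζ b := by
  intro heq
  by_cases hpar : (a : ℕ) % 2 ≠ (b : ℕ) % 2
  · have hk0 : (0 : ℤ) < D.k P a := by have := (hD.facts hV a).1; have := hV.rfacts.2.1; linarith
    have hk0' : (0 : ℤ) < D.k P b := by have := (hD.facts hV b).1; have := hV.rfacts.2.1; linarith
    rcases hD.hdiff a b hpar hi with h | h <;> linarith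
  · push Not at hpar
    have ha := a.isLt; have hb := b.isLt
    have hab' : (a : ℕ) ≠ b := fun h => hab (Fin.ext h)
    have h4 : ((a : ℕ) = 0 ∧ (b : ℕ) = 2) ∨ ((a : ℕ) = 2 ∧ (b : ℕ) = 0) ∨ ((a : ℕ) = 1 ∧ (b : ℕ) = 3) ∨ ((a : ℕ) = 3 ∧ (b : ℕ) = 1) := by
      omega
    rcases h4 with ⟨ha0, hb0⟩ | ⟨ha0, hb0⟩ | ⟨ha0, hb0⟩ | ⟨ha0, hb0⟩
    · have ea : a = 0 := Fin.ext ha0; have eb : b = 2 := Fin.ext hb0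
      subst ea; subst eb
      obtain ⟨c, -, -, hc3⟩ := hD.hsame02 hi; unfold SBtw at hc3; omega
    · have ea : a = 2 := Fin.ext ha0; have eb : b = 0 := Fin.ext hb0
      subst ea; subst eb
      obtain ⟨c, -, -, hc3⟩ := hD.hsame02 hi.symm; unfold SBtw at hc3; omega
    · have ea : a = 1 := Fin.ext ha0; have eb : b = 3 := Fin.ext hb0
      subst ea; subst eb
      obtain ⟨c, -, -, hc3⟩ := hD.hsame13 hi; unfold SBtw at hc3; omega
    · have ea : a = 3 := Fin.ext ha0; have eb : b = 1 := Fin.ext hb0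
      subst ea; subst eb
      obtain ⟨c, -, -, hc3⟩ := hD.hsame13 hi.symm; unfold SBtw at hc3; omega

/-- **Tip rows and spoke rows of distinct tips on a common frame compare alike.** [folklore] -/
theorem Good.zeta_lt_iff (hV : P.RValid) (hD : D.Good P) {a b : Fin 4} (hab : a ≠ b) (hi : D.i a = D.i b) :
    (D.ζ a < D.ζ b ↔ D.ξ P a < D.ξ P b) := by
  have hs0 : (0 : ℤ) ≤ P.s := by positivity
  constructor
  · intro h; linarith [hD.gap hV hab hi h]
  · intro h
    rcases lt_trichotomy (D.ζ a) (D.ζ b) with h' | h' | h'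
    · exact h'
    · exact absurd h' (hD.zeta_ne hV hab hi)
    · linarith [hD.gap hV (Ne.symm hab) hi.symm h']

/-- **Tip keys and spoke keys compare alike** (pairwise order isomorphism of the two families of keys). [folklore] -/
theorem Good.κz_lt_iff (hV : P.RValid) (hD : D.Good P) {a b : Fin 4} (hab : a ≠ b) :
    (D.κz P a < D.κz P b ↔ D.κ P a < D.κ P b) := by
  obtain ⟨-, -, -, -, -, -, -, xa1, xa2, za1, za2⟩ := hD.facts hV a
  obtain ⟨-, -, -, -, -, -, -, xb1, xb2, zb1, zb2⟩ := hD.facts hV b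
  have hs1 : (1 : ℤ) ≤ P.s := by have := hV.rfacts.1; have := hV.rfacts.2.1; linarith
  have hia := hD.hi a; have hib := hD.hi b
  unfold κz κ
  by_cases hi : D.i a = D.i b
  · rw [← hi, frKey_lt_frKey_iff (M := P.Mstar) hia, frKey_lt_frKey_iff (M := P.Mstar) hia, hD.zeta_lt_iff hV hab hi,
      hD.zeta_lt_iff hV (Ne.symm hab) hi.symm]
  · rw [frKey_lt_frKey_iff_of_ne hia hib hi za1 za2 zb1 zb2,
      frKey_lt_frKey_iff_of_ne hia hib hi (by linarith) (by linarith) (by linarith) (by linarith)]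

/-- **Spoke keys lie seven chunks inside their blocks.** [folklore] -/
theorem Good.κ_mem (hV : P.RValid) (hD : D.Good P) (a : Fin 4) :
    2 * (P.Mstar : ℤ) * (D.i a) + 7 * P.s ≤ D.κ P a ∧ D.κ P a + 7 * P.s ≤ 2 * (P.Mstar : ℤ) * (D.i a + 1) := by
  obtain ⟨-, -, -, -, -, -, -, xa1, xa2, -⟩ := hD.facts hV a
  exact frKey_bounds (hD.hi a) xa1 xa2.le

/-- **Spoke keys lie in `[0, 12M)`** with seven chunks to spare. [folklore] -/
theorem Good.κ_range (hV : P.RValid) (hD : D.Good P) (a : Fin 4) :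
    7 * (P.s : ℤ) ≤ D.κ P a ∧ D.κ P a + 7 * P.s ≤ 12 * P.Mstar := by
  obtain ⟨h1, h2⟩ := hD.κ_mem hV a
  have hi : (D.i a : ℤ) ≤ 5 := by have := hD.hi a; omega
  have hM : (0 : ℤ) ≤ P.Mstar := by positivity
  have hi0 : (0 : ℤ) ≤ D.i a := by positivity
  constructor <;> nlinarith

/-- Tip keys lie in `[0, 12M)`. [folklore] -/
theorem Good.κz_range (hV : P.RValid) (hD : D.Good P) (a : Fin 4) : 0 ≤ D.κz P a ∧ D.κz P a < 12 * P.Mstar := by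
  obtain ⟨-, -, -, -, -, -, -, -, -, za1, za2⟩ := hD.facts hV a
  have b := frKey_mem_block (M := P.Mstar) (hD.hi a) za1 za2
  have hi : (D.i a : ℤ) ≤ 5 := by have := hD.hi a; omega
  have hM : (0 : ℤ) ≤ P.Mstar := by positivity
  have hi0 : (0 : ℤ) ≤ D.i a := by positivity
  unfold κz
  constructor <;> nlinarith [b.1, b.2]

/-- **Distinct spoke keys are six chunks apart.** [folklore] -/
theorem Good.κ_far (hV : P.RValid) (hD : D.Good P) {a b : Fin 4} (hab : a ≠ b) :
    D.κ P a + 6 * P.s ≤ D.κ P b ∨ D.κ P b + 6 * P.s ≤ D.κ P a := by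
  have hs0 : (0 : ℤ) ≤ P.s := by positivity
  by_cases hi : D.i a = D.i b
  · have hia := hD.hi a
    rcases lt_trichotomy (D.ζ a) (D.ζ b) with h | h | h
    · have g := hD.gap hV hab hi h
      have e : D.κ P b = D.κ P a + orient (D.i a) * (D.ξ P b - D.ξ P a) := by
        unfold κ; rw [← hi, ← frKey_add hia]; ring_nf
      rw [e]; unfold orient; split_ifs <;> [right; left] <;> nlinarith
    · exact absurd h (hD.zeta_ne hV hab hi)
    · have g := hD.gap hV (Ne.symm hab) hi.symm h
      have e : D.κ P a = D.κ P b + orient (D.i b) * (D.ξ P a - D.ξ P b) := by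
        unfold κ; rw [hi, ← frKey_add (hD.hi b)]; ring_nf
      rw [e]; unfold orient; split_ifs <;> [left; right] <;> nlinarith
  · obtain ⟨a1, a2⟩ := hD.κ_mem hV a
    obtain ⟨b1, b2⟩ := hD.κ_mem hV b
    have hM : (0 : ℤ) ≤ P.Mstar := by positivity
    rcases Nat.lt_or_gt_of_ne hi with h | h
    · left; have : (D.i a : ℤ) + 1 ≤ D.i b := by exact_mod_cast h
      nlinarith
    · right; have : (D.i b : ℤ) + 1 ≤ D.i a := by exact_mod_cast h
      nlinarith

/-- **Target facts**: the target rows lie in the middle landing band, the target object's rows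
`[t, t + (d-1) s]` cover the approach rows `[t, t + N'/64]`, and the target keys lie seven chunks inside
their blocks. [folklore] -/
theorem tgt_facts (hV : P.RValid) (htc : ∀ e, tc e < 5) (e : Fin 4) :
    -(P.n : ℤ) + (P.n / 4 : ℕ) + (P.n / 16 : ℕ) ≤ t P tc e ∧ t P tc e ≤ -((P.n / 4 : ℕ) : ℤ) - (P.n / 16 : ℕ) ∧
      ((P.n / 64 : ℕ) : ℤ) ≤ ((P.d - 1 : ℕ) : ℤ) * P.s ∧ ((P.d - 1 : ℕ) : ℤ) * P.s ≤ (P.n / 64 : ℕ) + 2 * P.s ∧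
      -(2 * (P.Mstar : ℤ)) + 7 * P.s ≤ t P tc e ∧ t P tc e + ((P.d - 1 : ℕ) : ℤ) * P.s + 7 * P.s ≤ 0 ∧
      2 * (P.Mstar : ℤ) * (Slot4.ts e) + 7 * P.s ≤ γ P tc e ∧ γ P tc e + 7 * P.s ≤ 2 * (P.Mstar : ℤ) * (Slot4.ts e + 1) ∧
      Slot4.ts e < 6 := by
  obtain ⟨hs, hk₀, hμ, -, -, he1, -, -, -, hM1, hM2, hr1, hr2, hr3, -, hm, -, hn, -, hμM, -⟩ := hV.rfacts
  obtain ⟨t1, t2⟩ := hV.toValid.itgtRow4_mem hV.hK (htc e)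
  have hts : Slot4.ts e < 6 := by unfold Slot4.ts Slot4.bs; split_ifs <;> omega
  have hd : P.d - 1 = P.n / 64 / P.s + 2 := by unfold LParams.d; generalize P.n / 64 / P.s = x; omega
  have hk : 1 ≤ P.s := by have : P.s = P.k₀ := rfl; omega
  have hd1 : ((P.n / 64 : ℕ) : ℤ) ≤ ((P.d - 1 : ℕ) : ℤ) * P.s := by
    rw [hd]; have := Nat.lt_div_mul_add (a := P.n / 64) hk; push_cast at this ⊢; nlinarith
  have hd2 : ((P.d - 1 : ℕ) : ℤ) * P.s ≤ (P.n / 64 : ℕ) + 2 * P.s := by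
    rw [hd]; have := Nat.div_mul_le_self (P.n / 64) P.s; push_cast at this ⊢; nlinarith
  have hn4 : (P.n : ℤ) < 4 * ((P.n / 4 : ℕ) : ℤ) + 4 := by omega
  have hn16 : (0 : ℤ) ≤ ((P.n / 16 : ℕ) : ℤ) := by positivity
  have hn64 : 64 * ((P.n / 64 : ℕ) : ℤ) ≤ P.n := by omega
  have hds0 : (0 : ℤ) ≤ ((P.d - 1 : ℕ) : ℤ) * P.s := by positivity
  have he0 : (0 : ℤ) ≤ P.e := by positivity
  have ht1 : -(2 * (P.Mstar : ℤ)) + 7 * P.s ≤ t P tc e := by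
    unfold t; linarith only [t1, hM2, hr3, hn4, hn16, hμM, hμ, hs, hk₀, he0]
  have ht2 : t P tc e + ((P.d - 1 : ℕ) : ℤ) * P.s + 7 * P.s ≤ 0 := by
    unfold t; linarith only [t2, hd2, hn4, hn16, hn64, hμM, hμ, hs, hk₀]
  have ht3 : t P tc e + 7 * P.s ≤ 0 := by linarith only [ht2, hds0]
  refine ⟨t1, t2, hd1, hd2, ht1, ht2, ?_, ?_, hts⟩
  · exact (frKey_bounds hts ht1 ht3).1
  · exact (frKey_bounds hts ht1 ht3).2

/-- **A spoke key and a target key are six chunks apart** (targets off the danger zones). [folklore] -/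
theorem Good.κγ_far (hV : P.RValid) (hD : D.Good P) (htc : ∀ e, tc e < 5) (htgt : D.TgtOK P tc) (a e : Fin 4) :
    D.κ P a + 6 * P.s ≤ γ P tc e ∨ γ P tc e + 6 * P.s ≤ D.κ P a := by
  have hs0 : (0 : ℤ) ≤ P.s := by positivity
  have hμ : 32 * (P.k₀ : ℤ) ≤ P.μ := hV.rfacts.2.2.1
  have hsk : (P.s : ℤ) = P.k₀ := hV.rfacts.1
  obtain ⟨-, -, -, -, -, -, g1, g2, hts⟩ := tgt_facts hV htc e
  obtain ⟨a1, a2⟩ := hD.κ_mem hV a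
  by_cases hi : D.i a = Slot4.ts e
  · have e1 : γ P tc e = D.κ P a + orient (D.i a) * (t P tc e - D.ξ P a) := by
      unfold γ κ; rw [← hi, ← frKey_add (hD.hi a)]; ring_nf
    rw [e1]
    rcases htgt.out e a hi with h | h <;> unfold orient <;> split_ifs
    · right; nlinarith
    · left; nlinarith
    · left; have : (0 : ℤ) ≤ ((P.n / 64 : ℕ) : ℤ) := by positivity
      nlinarith
    · right; have : (0 : ℤ) ≤ ((P.n / 64 : ℕ) : ℤ) := by positivity
      nlinarith
  · have hM : (0 : ℤ) ≤ P.Mstar := by positivity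
    rcases Nat.lt_or_gt_of_ne hi with h | h
    · left; have : (D.i a : ℤ) + 1 ≤ Slot4.ts e := by exact_mod_cast h
      nlinarith
    · right; have : (Slot4.ts e : ℤ) + 1 ≤ D.i a := by exact_mod_cast h
      nlinarith

/-- **Target keys increase with the landing side**: `γ 0 < γ 1 < γ 2 < γ 3` (sides `0 < 2 < 3 < 5`). [folklore] -/
theorem γ_strictMono (hV : P.RValid) (htc : ∀ e, tc e < 5) : StrictMono (γ P tc) := by
  have hM : (0 : ℤ) ≤ P.Mstar := by positivity
  have hs0 : (0 : ℤ) ≤ P.s := by positivity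
  have hs1 : (1 : ℤ) ≤ P.s := by have := hV.rfacts.1; have := hV.rfacts.2.1; linarith
  have key : ∀ e e' : Fin 4, Slot4.ts e < Slot4.ts e' → γ P tc e < γ P tc e' := by
    intro e e' h
    obtain ⟨-, -, -, -, -, -, g1, g2, -⟩ := tgt_facts hV htc e
    obtain ⟨-, -, -, -, -, -, g1', g2', -⟩ := tgt_facts hV htc e'
    have : (Slot4.ts e : ℤ) + 1 ≤ Slot4.ts e' := by exact_mod_cast h
    have hmul := mul_le_mul_of_nonneg_left this hM
    linarith
  intro e e' h
  apply key
  have he := e.isLt; have he' := e'.isLt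
  have h' : (e : ℕ) < e' := h
  unfold Slot4.ts Slot4.bs; split_ifs <;> omega

/-- **The targets can be chosen off the danger zones**: each of the at most four tips of the frame
`ts e` excludes at most one of the five candidate rows (their spacing `sp` exceeds the length
`N'/64 + 2μ + 16 s` of a danger zone). [folklore] -/
theorem exists_tgt (D : ITipData) : ∃ tc : Fin 4 → ℕ, (∀ e, tc e < 5) ∧ D.TgtOK P tc := by
  classical
  have hsp : (P.isp : ℤ) = (P.n / 64 : ℕ) + 2 * P.μ + 16 * P.s + 1 := by unfold LParams.isp; push_cast; ring
  -- the candidates excluded for the side of `e`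
  have hex : ∀ e : Fin 4, ∃ c, c < 5 ∧ ∀ a, D.i a = Slot4.ts e →
      D.ξ P a + P.μ + 8 * P.s < P.itgtRow4 c ∨ P.itgtRow4 c + (P.n / 64 : ℕ) + P.μ + 8 * P.s < D.ξ P a := by
    intro e
    -- tip `a` excludes the candidate `c` iff `tgtRow4 c` lies in `[ξ a - N'/64 - μ - 8s, ξ a + μ + 8s]`
    let bad : Fin 4 → Finset ℕ := fun a => (Finset.range 5).filter fun c =>
      ¬ (D.ξ P a + P.μ + 8 * P.s < P.itgtRow4 c ∨ P.itgtRow4 c + (P.n / 64 : ℕ) + P.μ + 8 * P.s < D.ξ P a)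
    have hbad : ∀ a, (bad a).card ≤ 1 := by
      intro a
      refine Finset.card_le_one.2 fun c hc c' hc' => ?_
      simp only [bad, Finset.mem_filter, Finset.mem_range, not_or, not_lt] at hc hc'
      have e1 : P.itgtRow4 c = tgtRow P.n false + c * P.isp := rfl
      have e2 : P.itgtRow4 c' = tgtRow P.n false + c' * P.isp := rfl
      by_contra hne
      rcases Nat.lt_or_gt_of_ne hne with h | h
      · have : (c : ℤ) + 1 ≤ c' := by exact_mod_cast h
        have hsp0 : (0 : ℤ) ≤ P.isp := by positivity
        nlinarith [hc.2.1, hc.2.2, hc'.2.1, hc'.2.2]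
      · have : (c' : ℤ) + 1 ≤ c := by exact_mod_cast h
        have hsp0 : (0 : ℤ) ≤ P.isp := by positivity
        nlinarith [hc.2.1, hc.2.2, hc'.2.1, hc'.2.2]
    have hU : (Finset.univ.biUnion bad).card < (Finset.range 5).card := by
      calc (Finset.univ.biUnion bad).card ≤ ∑ a, (bad a).card := Finset.card_biUnion_le
        _ ≤ ∑ _a : Fin 4, 1 := Finset.sum_le_sum fun a _ => hbad a
        _ < (Finset.range 5).card := by simp
    have hsub : ¬ Finset.range 5 ⊆ Finset.univ.biUnion bad := fun h =>
      absurd (Finset.card_le_card h) (not_le.2 hU)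
    rw [Finset.not_subset] at hsub
    obtain ⟨c, hc, hcU⟩ := hsub
    refine ⟨c, Finset.mem_range.1 hc, fun a ha => ?_⟩
    by_contra hno
    exact hcU (Finset.mem_biUnion.2 ⟨a, Finset.mem_univ _, Finset.mem_filter.2 ⟨hc, hno⟩⟩)
  choose tc htc htgt using hex
  exact ⟨tc, htc, ⟨fun e a ha => htgt e a ha⟩⟩

end ITipData

namespace ITipData

/-! ### The routing certificate -/

variable (P : LParams) (D : ITipData) (tc : Fin 4 → ℕ) (R : TipData.Route)

/-- the tips, read from the cut [folklore] -/
def Tq (q : Fin 4) : ℤ := cyc (12 * P.Mstar) R.c (D.κ P (R.jt + q + 1))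
/-- the targets, read from the cut [folklore] -/
def Gq (q : Fin 4) : ℤ := cyc (12 * P.Mstar) R.c (γ P tc (R.kt + q))
/-- the level of the ring road of the landing side `e` [folklore] -/
def lv (e : Fin 4) : ℕ := laneLevel (Tq P D R) (Gq P tc R) (R.q e)
/-- the cut row (on the frame of the tip `1`) [folklore] -/
def ρC : ℤ := if R.up then D.ξ P 1 + orient (D.i 1) * (3 * P.s) else D.ξ P 1 - orient (D.i 1) * (3 * P.s)
/-- the cut object [folklore] -/
def C : RingObj := ⟨D.i 1, ρC P D R, ρC P D R⟩
/-- the tip object of the tip `a` (its spoke row) [folklore] -/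
def X (a : Fin 4) : RingObj := ⟨D.i a, D.ξ P a, D.ξ P a⟩
/-- the target object of the landing side `e` (approach rows and exit run) [folklore] -/
def Y (e : Fin 4) : RingObj := ⟨Slot4.ts e, t P tc e, t P tc e + ((P.d - 1 : ℕ) : ℤ) * P.s⟩
/-- chunks per side of the ring of `e` [folklore] -/
def nE (e : Fin 4) : ℕ := P.inL (lv P D tc R e)
/-- radius of the ring of `e` [folklore] -/
def rE (e : Fin 4) : ℕ := P.irL (lv P D tc R e)
/-- tubes of the ring of `e` [folklore] -/
def GE (e : Fin 4) : ℕ := P.iGr (lv P D tc R e)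
/-- the cut position on the ring of `e` [folklore] -/
def pc (e : Fin 4) : ℕ := (C P D R).cutPos (nE P D tc R e) P.s (rE P D tc R e)
/-- read position on the ring of `e` [folklore] -/
def lp (e : Fin 4) (p : ℕ) : ℕ := linPos (GE P D tc R e) (pc P D tc R e) p
/-- start of the hull of `e` (read position) [folklore] -/
def hs (e : Fin 4) : ℕ :=
  min (lp P D tc R e ((X P D (R.tip e)).wlo (nE P D tc R e) P.s (rE P D tc R e)))
    (lp P D tc R e ((Y P tc e).wlo (nE P D tc R e) P.s (rE P D tc R e)))
/-- end of the hull of `e` (read position) [folklore] -/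
def he (e : Fin 4) : ℕ :=
  max (lp P D tc R e ((X P D (R.tip e)).whi (nE P D tc R e) P.s (rE P D tc R e)))
    (lp P D tc R e ((Y P tc e).whi (nE P D tc R e) P.s (rE P D tc R e)))
/-- start of the arc of `e` (absolute position) [folklore] -/
def astAbs (e : Fin 4) : ℕ := (pc P D tc R e + hs P D tc R e) % GE P D tc R e
/-- length of the arc of `e` [folklore] -/
def alnE (e : Fin 4) : ℕ := he P D tc R e - hs P D tc R e + 1
/-- the half-turn of the reading configuration of `e` [folklore] -/
def shE (e : Fin 4) : ℕ := if 2 ≤ (e : ℕ) then 6 * nE P D tc R e - 2 else 0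
/-- start of the arc of `e` (reading position) [folklore] -/
def astE (e : Fin 4) : ℕ := (astAbs P D tc R e + GE P D tc R e - shE P D tc R e) % GE P D tc R e
/-- the rows of the routed slot [folklore] -/
def slotF : Fin 7 → Fin 4 → ℕ :=
  ![fun e => D.i (R.tip e), fun e => D.j (R.tip e), fun e => D.ν (R.tip e), tc, lv P D tc R, astE P D tc R, alnE P D tc R]
/-- **The routed slot.** [folklore] -/
def slot : InSlot4 := ⟨slotF P D tc R, decide (R.tip 0 = 2)⟩

/-- **A good routing certificate for the inner tip data** (what `Lanes.exists_cut'` provides; the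
certificate itself is `TipData.Route`): the cut key is `κ 1 ± 3s`, the
tips and the targets read increasingly from the cut, all at least three chunks from it, and the parities
of the two rotations are complementary (the first tip after the cut and the first target have the same
colour). [folklore] -/
structure RouteGood : Prop where
  /-- the cut key -/
  hc : R.c = (if R.up then D.κ P 1 + 3 * P.s else D.κ P 1 - 3 * P.s)
  /-- range of the cut key -/
  hc_range : 0 ≤ R.c ∧ R.c < 12 * P.Mstar
  /-- the tips read increasingly -/
  hτ : Tq P D R 0 < Tq P D R 1 ∧ Tq P D R 1 < Tq P D R 2 ∧ Tq P D R 2 < Tq P D R 3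
  /-- the targets read increasingly -/
  hγ : Gq P tc R 0 < Gq P tc R 1 ∧ Gq P tc R 1 < Gq P tc R 2 ∧ Gq P tc R 2 < Gq P tc R 3
  /-- tips off the cut -/
  hfarτ : ∀ a, 3 * (P.s : ℤ) ≤ cyc (12 * P.Mstar) R.c (D.κ P a)
  /-- targets off the cut -/
  hfarγ : ∀ e, 3 * (P.s : ℤ) ≤ cyc (12 * P.Mstar) R.c (γ P tc e)
  /-- parities -/
  hpar : ((R.jt : ℕ) % 2 = 1 ↔ (R.kt : ℕ) % 2 = 0)

variable {P D tc R}

/-- **The routing certificate exists** (order certificate of the tips from a base point `b₀`, targets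
off the danger zones). [cite: Nolin2008, §4.3 Prop. 12 (i), §4.4 p. 12 (arXiv 0711.4948: Prop. 11; relocation of landing areas)] -/
theorem exists_route (hV : P.RValid) (hD : D.Good P) (htc : ∀ e, tc e < 5) (htgt : D.TgtOK P tc)
    (hchain : ∃ b₀ : ℤ, 0 ≤ b₀ ∧ b₀ < 12 * P.Mstar ∧ cyc (12 * P.Mstar) b₀ (D.κz P 1) < cyc (12 * P.Mstar) b₀ (D.κz P 2) ∧
      cyc (12 * P.Mstar) b₀ (D.κz P 2) < cyc (12 * P.Mstar) b₀ (D.κz P 3) ∧ cyc (12 * P.Mstar) b₀ (D.κz P 3) < cyc (12 * P.Mstar) b₀ (D.κz P 0)) :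
    ∃ R : TipData.Route, RouteGood P D tc R := by
  obtain ⟨b₀, hb0, hb1, c1, c2, c3⟩ := hchain
  have hs1 : (1 : ℤ) ≤ P.s := by have := hV.rfacts.1; have := hV.rfacts.2.1; linarith
  set Pm : ℤ := 12 * P.Mstar with hPm
  have zr := fun a => hD.κz_range hV a
  have kr : ∀ a, 0 ≤ D.κ P a ∧ D.κ P a < Pm := fun a => by have := hD.κ_range hV a; constructor <;> linarith
  have gr : ∀ e, 0 ≤ γ P tc e ∧ γ P tc e < Pm := fun e => by
    obtain ⟨-, -, -, -, -, -, g1, g2, hts⟩ := tgt_facts hV htc e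
    have hM : (0 : ℤ) ≤ P.Mstar := by positivity
    have h6 : (Slot4.ts e : ℤ) ≤ 5 := by omega
    have h0 : (0 : ℤ) ≤ Slot4.ts e := by positivity
    constructor <;> nlinarith
  -- rebase the certificate at the tip `1`, then pass to the spoke keys
  have cyc_of_le : ∀ {y x : ℤ}, y ≤ x → cyc Pm y x = x - y := fun h => if_pos h
  have r2 : cyc Pm (D.κz P 1) (D.κz P 2) = cyc Pm b₀ (D.κz P 2) - cyc Pm b₀ (D.κz P 1) := by
    rw [cyc_rebase ⟨hb0, hb1⟩ (zr 1) (zr 2), cyc_of_le c1.le]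
  have r3 : cyc Pm (D.κz P 1) (D.κz P 3) = cyc Pm b₀ (D.κz P 3) - cyc Pm b₀ (D.κz P 1) := by
    rw [cyc_rebase ⟨hb0, hb1⟩ (zr 1) (zr 3), cyc_of_le (c1.trans c2).le]
  have r0 : cyc Pm (D.κz P 1) (D.κz P 0) = cyc Pm b₀ (D.κz P 0) - cyc Pm b₀ (D.κz P 1) := by
    rw [cyc_rebase ⟨hb0, hb1⟩ (zr 1) (zr 0), cyc_of_le ((c1.trans c2).trans c3).le]
  have z12 : cyc Pm (D.κz P 1) (D.κz P 2) < cyc Pm (D.κz P 1) (D.κz P 3) := by rw [r2, r3]; linarith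
  have z23 : cyc Pm (D.κz P 1) (D.κz P 3) < cyc Pm (D.κz P 1) (D.κz P 0) := by rw [r3, r0]; linarith
  have iso := fun {a b : Fin 4} (h : a ≠ b) => hD.κz_lt_iff hV h
  have t12 : cyc Pm (D.κ P 1) (D.κ P 2) < cyc Pm (D.κ P 1) (D.κ P 3) :=
    (cyc_lt_cyc_iff_of_iso (zr 2) (zr 3) (kr 2) (kr 3) (iso (by decide)) (iso (by decide)) (iso (by decide))
      (iso (by decide)) (iso (by decide))).1 z12
  have t23 : cyc Pm (D.κ P 1) (D.κ P 3) < cyc Pm (D.κ P 1) (D.κ P 0) :=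
    (cyc_lt_cyc_iff_of_iso (zr 3) (zr 0) (kr 3) (kr 0) (iso (by decide)) (iso (by decide)) (iso (by decide))
      (iso (by decide)) (iso (by decide))).1 z23
  -- separations
  have far := fun {x y : ℤ} (hx : 0 ≤ x) (hy : 0 ≤ y) (hxP : x + 6 * P.s ≤ Pm) (hyP : y + 6 * P.s ≤ Pm)
    (hxy : x + 6 * P.s ≤ y ∨ y + 6 * P.s ≤ x) => cyc_far (P := Pm) hx hy hxP hyP hxy
  have kP : ∀ a, D.κ P a + 6 * P.s ≤ Pm := fun a => by have := (hD.κ_range hV a).2; linarith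
  have gP : ∀ e, γ P tc e + 6 * P.s ≤ Pm := fun e => by
    obtain ⟨-, -, -, -, -, -, -, g2, hts⟩ := tgt_facts hV htc e
    have hM : (0 : ℤ) ≤ P.Mstar := by positivity
    have h6 : (Slot4.ts e : ℤ) ≤ 5 := by omega
    nlinarith
  have sepτ1 := far (kr 1).1 (kr 2).1 (kP 1) (kP 2) (hD.κ_far hV (by decide))
  have sepτ3 := far (kr 1).1 (kr 0).1 (kP 1) (kP 0) (hD.κ_far hV (by decide))
  have sepγ : ∀ e, 2 * (3 * (P.s : ℤ)) ≤ cyc Pm (D.κ P 1) (γ P tc e) ∧ cyc Pm (D.κ P 1) (γ P tc e) ≤ Pm - 2 * (3 * P.s) := by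
    intro e
    have := far (kr 1).1 (gr e).1 (kP 1) (gP e) (hD.κγ_far hV htc htgt 1 e)
    constructor <;> linarith [this.1, this.2]
  -- targets: increasing keys
  have gmono := γ_strictMono (P := P) (tc := tc) hV htc
  have g01 : γ P tc 0 < γ P tc 1 := gmono (by decide)
  have g12 : γ P tc 1 < γ P tc 2 := gmono (by decide)
  have g23 : γ P tc 2 < γ P tc 3 := gmono (by decide)
  have hγcyc : cyc Pm (γ P tc 0) (γ P tc 1) < cyc Pm (γ P tc 0) (γ P tc 2) ∧
      cyc Pm (γ P tc 0) (γ P tc 2) < cyc Pm (γ P tc 0) (γ P tc 3) := by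
    unfold cyc; rw [if_pos g01.le, if_pos (g01.trans g12).le, if_pos ((g01.trans g12).trans g23).le]
    constructor <;> linarith
  have hγ1 : 0 < cyc Pm (γ P tc 0) (γ P tc 1) := by unfold cyc; rw [if_pos g01.le]; linarith
  -- the cut
  obtain ⟨c, hc0, hc1, hcform, jt, kt, hτo, hγo, hfτ, hfγ, hpar⟩ :=
    exists_cut' (P := Pm) (h := 3 * P.s) (by linarith) (τ := fun j => D.κ P (j + 1)) (γ := γ P tc) false
      (fun j => kr (j + 1)) gr (by exact ⟨t12, t23⟩) hγcyc hγ1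
      (by show 2 * (3 * (P.s : ℤ)) ≤ cyc Pm (D.κ P 1) (D.κ P 2) ∧ cyc Pm (D.κ P 1) (D.κ P 0) ≤ Pm - 2 * (3 * P.s)
          exact ⟨by linarith [sepτ1.1], by linarith [sepτ3.2]⟩) sepγ
  -- which side of `κ 1` the cut is
  have hk1 := hD.κ_range hV 1
  have hform : ∃ up : Bool, c = (if up then D.κ P 1 + 3 * P.s else D.κ P 1 - 3 * P.s) := by
    rcases hcform with h | h
    · refine ⟨false, ?_⟩
      rw [h]; simp only [show ((0 : Fin 4) + 1 : Fin 4) = 1 from rfl]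
      rw [if_pos (by linarith)]; simp
    · refine ⟨true, ?_⟩
      rw [h]; simp only [show ((0 : Fin 4) + 1 : Fin 4) = 1 from rfl]
      rw [if_pos (by linarith)]; simp
  obtain ⟨up, hup⟩ := hform
  refine ⟨⟨c, jt, kt, up⟩, hup, ⟨hc0, hc1⟩, ?_, ?_, fun a => ?_, fun e => (hfγ e).1, ?_⟩
  · simp only [Tq]
    simp only [show jt + 0 + 1 = jt + 1 from by rw [add_zero]] 
    exact hτo
  · simp only [Gq]
    simp only [show kt + 0 = kt from add_zero kt]
    exact hγo
  · have := (hfτ (a - 1)).1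
    simp only [sub_add_cancel] at this
    exact this
  · have h := hpar
    simp only [Bool.false_xor] at h
    constructor
    · intro hj
      have : decide ((jt : ℕ) % 2 = 1) = true := by simpa using hj
      rw [this] at h; simpa using h.symm
    · intro hk
      have : decide ((kt : ℕ) % 2 = 0) = true := by simpa using hk
      rw [this] at h; simpa using h

/-! ### Reading the certificate -/

/-- **The routed tip has the colour of its landing side** (good certificate). [folklore] -/
theorem RouteGood.tip_parity (hR : RouteGood P D tc R) (e : Fin 4) : ((R.tip e : Fin 4) : ℕ) % 2 = (e : ℕ) % 2 := by
  have h := hR.hpar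
  rw [TipData.Route.tip_val]
  have hj := R.jt.isLt; have hk := R.kt.isLt; have he := e.isLt
  omega

/-- Arms of different colours are routed from tips of different colours. [folklore] -/
theorem RouteGood.tip_parity_ne (hR : RouteGood P D tc R) {e b : Fin 4} (h : Slot4.col e ≠ Slot4.col b) :
    ((R.tip e : Fin 4) : ℕ) % 2 ≠ ((R.tip b : Fin 4) : ℕ) % 2 := by
  rw [hR.tip_parity, hR.tip_parity]
  intro h'
  apply h
  unfold Slot4.col
  rw [h']


/-- The targets read at the reading index of their side. [folklore] -/
theorem Gq_q (e : Fin 4) : Gq P tc R (R.q e) = cyc (12 * P.Mstar) R.c (γ P tc e) := by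
  unfold Gq TipData.Route.q; rw [add_sub_cancel]

/-- The key of the cut row is the cut key. [folklore] -/
theorem key_C (hD : D.Good P) (hR : RouteGood P D tc R) : frKey P.Mstar (D.i 1) (ρC P D R) = R.c := by
  have ho := orient_mul_orient (D.i 1)
  rw [hR.hc]; unfold ρC κ
  cases hu : R.up
  · simp only [Bool.false_eq_true, if_false]
    rw [sub_eq_add_neg, frKey_add (hD.hi 1)]
    linear_combination (-(3 * (P.s : ℤ))) * ho
  · simp only [if_true]
    rw [frKey_add (hD.hi 1)]
    linear_combination (3 * (P.s : ℤ)) * ho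

/-- The cut row is three chunks above or below the spoke row of the tip `1`. [folklore] -/
theorem ρC_cases (R : TipData.Route) : ρC P D R = D.ξ P 1 + 3 * P.s ∨ ρC P D R = D.ξ P 1 - 3 * P.s := by
  unfold ρC orient
  split_ifs <;> first | (left; ring1) | (right; ring1)

/-- **The ring of the landing side `e`.** [folklore] -/
theorem ringE_facts (hV : P.RValid) (e : Fin 4) :
    1 ≤ nE P D tc R e ∧ ((nE P D tc R e : ℕ) : ℤ) * P.s = rE P D tc R e ∧ 2 * P.Mstar ≤ rE P D tc R e ∧
      GE P D tc R e = 12 * nE P D tc R e - 4 ∧ nE P D tc R e ≤ P.inL 0 ∧ lv P D tc R e < 8 := by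
  have hlv : lv P D tc R e < 8 := laneLevel_lt _ _ _
  obtain ⟨-, h2, h3, h4, -, -, -, h7, -⟩ := hV.toValid.iring_facts hlv
  obtain ⟨g1, -, g3, -, -, -, -, -, -⟩ := hV.toValid.iring_facts (show 7 < 8 by norm_num)
  obtain ⟨hs, -, -, -, hk₀, -, -, -, -, -, -, -, hm, -, hn, hμn, -⟩ := hV.toValid.facts
  have hμ7 : (2 * lv P D tc R e + 1) * P.μ ≤ (2 * 7 + 1) * P.μ := Nat.mul_le_mul_right _ (by omega)
  have hle : P.irL 7 ≤ P.irL (lv P D tc R e) := by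
    unfold LParams.irL
    exact Nat.mul_le_mul_left _ (Nat.div_le_div_right (by omega))
  have hn7 : P.inL (lv P D tc R e) ≤ P.inL 0 := hV.toValid.inL_le_inL_zero hlv
  have hM : 2 * P.Mstar ≤ P.irL 7 := by unfold LParams.Mstar; omega
  exact ⟨h4, by exact_mod_cast h3, by unfold rE; omega, h7, hn7, hlv⟩

/-- The cut object is in range on every ring. [folklore] -/
theorem C_ok (hV : P.RValid) (hD : D.Good P) (e : Fin 4) : (C P D R).OK P.s (rE P D tc R e) P.Mstar := by
  obtain ⟨-, -, -, -, -, -, -, x1, x2, -⟩ := hD.facts hV 1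
  obtain ⟨-, -, hMr, -⟩ := ringE_facts (D := D) (tc := tc) (R := R) hV e
  have hs0 : (0 : ℤ) ≤ P.s := by positivity
  rcases ρC_cases (P := P) (D := D) R with h | h <;>
    exact ⟨hD.hi 1, le_rfl, by show _ ≤ ρC P D R; rw [h]; linarith, by show ρC P D R + _ < 0; rw [h]; linarith, hMr⟩

/-- The tip objects are in range on every ring. [folklore] -/
theorem X_ok (hV : P.RValid) (hD : D.Good P) (a e : Fin 4) : (X P D a).OK P.s (rE P D tc R e) P.Mstar := by
  obtain ⟨-, -, -, -, -, -, -, x1, x2, -⟩ := hD.facts hV a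
  obtain ⟨-, -, hMr, -⟩ := ringE_facts (D := D) (tc := tc) (R := R) hV e
  have hs0 : (0 : ℤ) ≤ P.s := by positivity
  exact ⟨hD.hi a, le_rfl, by show _ ≤ D.ξ P a; linarith, by show D.ξ P a + _ < 0; linarith, hMr⟩

/-- The target objects are in range on every ring. [folklore] -/
theorem Y_ok (hV : P.RValid) (htc : ∀ e, tc e < 5) (e' e : Fin 4) : (Y P tc e').OK P.s (rE P D tc R e) P.Mstar := by
  obtain ⟨-, -, -, -, t1, t2, -, -, hts⟩ := tgt_facts hV htc e'
  obtain ⟨-, -, hMr, -⟩ := ringE_facts (D := D) (tc := tc) (R := R) hV e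
  have hs1 : (1 : ℤ) ≤ P.s := by have := hV.rfacts.1; have := hV.rfacts.2.1; linarith
  have hd0 : (0 : ℤ) ≤ ((P.d - 1 : ℕ) : ℤ) * P.s := by positivity
  exact ⟨hts, by show t P tc e' ≤ t P tc e' + _; linarith, by show _ ≤ t P tc e'; linarith,
    by show t P tc e' + _ + _ < 0; linarith, hMr⟩

/-- The tip objects are comparable with the cut (two chunks). [folklore] -/
theorem X_cut (hV : P.RValid) (hD : D.Good P) (a : Fin 4) :
    RingObj.Before 2 P.s (X P D a) (C P D R) ∨ RingObj.Before 2 P.s (C P D R) (X P D a) := by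
  apply TipData.before_or
  show D.i a ≠ D.i 1 ∨ D.ξ P a + 2 * P.s ≤ ρC P D R ∨ ρC P D R + 2 * P.s ≤ D.ξ P a
  by_cases hi : D.i a = D.i 1
  · right
    have hs0 : (0 : ℤ) ≤ P.s := by positivity
    rcases ρC_cases (P := P) (D := D) R with h | h <;> rw [h]
    · by_cases ha : a = 1
      · subst ha; left; linarith
      · rcases lt_trichotomy (D.ζ a) (D.ζ 1) with hl | hl | hl
        · have := hD.gap hV ha hi hl; left; linarith
        · exact absurd hl (hD.zeta_ne hV ha hi)
        · have := hD.gap hV (Ne.symm ha) hi.symm hl; right; linarith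
    · by_cases ha : a = 1
      · subst ha; right; linarith
      · rcases lt_trichotomy (D.ζ a) (D.ζ 1) with hl | hl | hl
        · have := hD.gap hV ha hi hl; left; linarith
        · exact absurd hl (hD.zeta_ne hV ha hi)
        · have := hD.gap hV (Ne.symm ha) hi.symm hl; right; linarith
  · exact Or.inl hi

/-- The target objects are comparable with the cut (two chunks). [folklore] -/
theorem Y_cut (hV : P.RValid) (htc : ∀ e, tc e < 5) (htgt : D.TgtOK P tc) (e' : Fin 4) :
    RingObj.Before 2 P.s (Y P tc e') (C P D R) ∨ RingObj.Before 2 P.s (C P D R) (Y P tc e') := by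
  apply TipData.before_or
  show Slot4.ts e' ≠ D.i 1 ∨ t P tc e' + ((P.d - 1 : ℕ) : ℤ) * P.s + 2 * P.s ≤ ρC P D R ∨ ρC P D R + 2 * P.s ≤ t P tc e'
  by_cases hi : D.i 1 = Slot4.ts e'
  · right
    have hs0 : (0 : ℤ) ≤ P.s := by positivity
    have hμ : 32 * (P.k₀ : ℤ) ≤ P.μ := hV.rfacts.2.2.1
    have hsk : (P.s : ℤ) = P.k₀ := hV.rfacts.1
    obtain ⟨-, -, -, hd2, -⟩ := tgt_facts hV htc e'
    rcases ρC_cases (P := P) (D := D) R with h | h <;> rw [h] <;> rcases htgt.out e' 1 hi with h' | h'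
    · right; linarith
    · left; linarith
    · right; linarith
    · left; linarith
  · exact Or.inl (Ne.symm hi)

/-- Distinct tip objects are separated. [folklore] -/
theorem sep_XX (hV : P.RValid) (hD : D.Good P) {a b : Fin 4} (hab : a ≠ b) : RingObj.Sep P.s (X P D a) (X P D b) := by
  intro hi
  show D.ξ P a + 3 * P.s ≤ D.ξ P b ∨ D.ξ P b + 3 * P.s ≤ D.ξ P a
  have hs0 : (0 : ℤ) ≤ P.s := by positivity
  rcases lt_trichotomy (D.ζ a) (D.ζ b) with hl | hl | hl
  · have := hD.gap hV hab hi hl; left; linarith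
  · exact absurd hl (hD.zeta_ne hV hab hi)
  · have := hD.gap hV (Ne.symm hab) (Eq.symm hi) hl; right; linarith

/-- A tip object and a target object are separated. [folklore] -/
theorem sep_XY (hV : P.RValid) (htc : ∀ e, tc e < 5) (htgt : D.TgtOK P tc) (a e' : Fin 4) :
    RingObj.Sep P.s (X P D a) (Y P tc e') := by
  intro hi
  show D.ξ P a + 3 * P.s ≤ t P tc e' ∨ t P tc e' + ((P.d - 1 : ℕ) : ℤ) * P.s + 3 * P.s ≤ D.ξ P a
  have hs0 : (0 : ℤ) ≤ P.s := by positivity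
  have hμ : 32 * (P.k₀ : ℤ) ≤ P.μ := hV.rfacts.2.2.1
  have hsk : (P.s : ℤ) = P.k₀ := hV.rfacts.1
  obtain ⟨-, -, -, hd2, -⟩ := tgt_facts hV htc e'
  rcases htgt.out e' a hi with h | h
  · left; linarith
  · right; linarith

/-- Distinct target objects are separated (they are on distinct frames). [folklore] -/
theorem sep_YY {e e' : Fin 4} (h : e ≠ e') : RingObj.Sep P.s (Y P tc e) (Y P tc e') := fun hf => absurd hf (TipData.ts_ne h)

/-- **No tip reads like a target** from the cut. [folklore] -/
theorem Tq_ne_Gq (hV : P.RValid) (hD : D.Good P) (htc : ∀ e, tc e < 5) (htgt : D.TgtOK P tc)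
    (q q' : Fin 4) : Tq P D R q ≠ Gq P tc R q' := by
  intro h
  unfold Tq Gq at h
  have hs1 : (1 : ℤ) ≤ P.s := by have := hV.rfacts.1; have := hV.rfacts.2.1; linarith
  have kr : 0 ≤ D.κ P (R.jt + q + 1) ∧ D.κ P (R.jt + q + 1) < 12 * P.Mstar := by
    have := hD.κ_range hV (R.jt + q + 1); constructor <;> linarith
  have gr : 0 ≤ γ P tc (R.kt + q') ∧ γ P tc (R.kt + q') < 12 * P.Mstar := by
    obtain ⟨-, -, -, -, -, -, g1, g2, hts⟩ := tgt_facts hV htc (R.kt + q')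
    have hM : (0 : ℤ) ≤ P.Mstar := by positivity
    have h6 : (Slot4.ts (R.kt + q') : ℤ) ≤ 5 := by omega
    have h0 : (0 : ℤ) ≤ Slot4.ts (R.kt + q') := by positivity
    constructor <;> nlinarith
  have heq := eq_of_cyc_eq kr gr h
  rcases hD.κγ_far hV htc htgt (R.jt + q + 1) (R.kt + q') with h' | h' <;> linarith

/-- **The hull facts of the landing side `e`**: the cut position and the hull ends are positions of the
ring, and the hull contains the read windows of the arm's own tip and target. [folklore] -/
theorem hull_facts (hV : P.RValid) (hD : D.Good P) (e : Fin 4) :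
    pc P D tc R e < GE P D tc R e ∧ hs P D tc R e ≤ he P D tc R e ∧ he P D tc R e < GE P D tc R e ∧
      hs P D tc R e ≤ lp P D tc R e ((X P D (R.tip e)).wlo (nE P D tc R e) P.s (rE P D tc R e)) ∧
      lp P D tc R e ((X P D (R.tip e)).whi (nE P D tc R e) P.s (rE P D tc R e)) ≤ he P D tc R e ∧
      hs P D tc R e ≤ lp P D tc R e ((Y P tc e).wlo (nE P D tc R e) P.s (rE P D tc R e)) ∧
      lp P D tc R e ((Y P tc e).whi (nE P D tc R e) P.s (rE P D tc R e)) ≤ he P D tc R e := by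
  obtain ⟨hn1, hns, -, hG, -⟩ := ringE_facts (D := D) (tc := tc) (R := R) hV e
  have hs1 : 1 ≤ P.s := by have := hV.toValid.facts.1; have := hV.toValid.facts.2.2.2.2.1; omega
  have hC := C_ok (tc := tc) (R := R) hV hD e
  have hXe := X_ok (tc := tc) (R := R) hV hD (R.tip e) e
  obtain ⟨-, -, bc, ec⟩ := RingObj.window_mem_block (n := nE P D tc R e) hC hs1 hns
  have hpc := (RingObj.wlo_le_cutPos (n := nE P D tc R e) hC hs1 hns).2
  have hpcG : pc P D tc R e < GE P D tc R e := by unfold pc; rw [hG]; omega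
  obtain ⟨-, wx, -, -⟩ := RingObj.window_mem_block (n := nE P D tc R e) hXe hs1 hns
  have wX := RingObj.linPos_window (n := nE P D tc R e) hXe hC hs1 hns (X_cut (R := R) hV hD (R.tip e)) ⟨le_rfl, wx⟩
  have hGpos : 0 < GE P D tc R e := by omega
  refine ⟨hpcG, ?_, ?_, min_le_left _ _, le_max_left _ _, min_le_right _ _, le_max_right _ _⟩
  · calc hs P D tc R e ≤ lp P D tc R e ((X P D (R.tip e)).wlo (nE P D tc R e) P.s (rE P D tc R e)) := min_le_left _ _
      _ ≤ lp P D tc R e ((X P D (R.tip e)).whi (nE P D tc R e) P.s (rE P D tc R e)) := by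
          unfold lp GE LParams.iGr; unfold nE at wX; exact wX.1.trans wX.2
      _ ≤ he P D tc R e := le_max_left _ _
  · unfold he lp linPos
    exact max_lt (Nat.mod_lt _ hGpos) (Nat.mod_lt _ hGpos)

/-- **The exclusion lemma.** For arms `e`, `b` of different colours: if the ring of `b` is higher, every
position of the spoke window of `b` on the ring of `e` reads outside the hull of `e`; if it is lower,
every position of the approach window of `b` on the ring of `e` reads outside the hull of `e`
(`Lanes.lanes_linear` and `RingObj.linPos_lt_of_cyc_lt`). [cite: Nolin2008, §4.3 Prop. 12 (i), Lemma 13 (arXiv 0711.4948: Prop. 11, Lemma 12)] -/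
theorem excl (hV : P.RValid) (hD : D.Good P) (htc : ∀ e, tc e < 5) (htgt : D.TgtOK P tc) (hR : RouteGood P D tc R)
    {e b : Fin 4} (hcol : Slot4.col e ≠ Slot4.col b) :
    (lv P D tc R e < lv P D tc R b → ∀ p, (X P D (R.tip b)).wlo (nE P D tc R e) P.s (rE P D tc R e) ≤ p →
      p ≤ (X P D (R.tip b)).whi (nE P D tc R e) P.s (rE P D tc R e) → lp P D tc R e p < hs P D tc R e ∨ he P D tc R e < lp P D tc R e p) ∧
    (lv P D tc R b < lv P D tc R e → ∀ p, (Y P tc b).wlo (nE P D tc R e) P.s (rE P D tc R e) ≤ p →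
      p ≤ (Y P tc b).whi (nE P D tc R e) P.s (rE P D tc R e) → lp P D tc R e p < hs P D tc R e ∨ he P D tc R e < lp P D tc R e p) := by
  have heb : e ≠ b := fun h => hcol (h ▸ rfl)
  have hqq : R.q e ≠ R.q b := R.q_ne heb
  have htt : R.tip e ≠ R.tip b := R.tip_ne heb
  have hT : StrictMono (Tq P D R) := TipData.strictMono_four hR.hτ.1 hR.hτ.2.1 hR.hτ.2.2
  have hG : StrictMono (Gq P tc R) := TipData.strictMono_four hR.hγ.1 hR.hγ.2.1 hR.hγ.2.2
  obtain ⟨l1, l2⟩ := lanes_linear hT hG (Tq_ne_Gq hV hD htc htgt) hqq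
  rw [Gq_q] at l1 l2
  change (lv P D tc R e < lv P D tc R b → cyc (12 * P.Mstar) R.c (D.κ P (R.tip b)) < min (cyc (12 * P.Mstar) R.c (D.κ P (R.tip e))) _ ∨ _) at l1
  change (lv P D tc R b < lv P D tc R e → _) at l2
  rw [Gq_q] at l2
  -- ring data
  obtain ⟨hn1, hns, -, hGE, -⟩ := ringE_facts (D := D) (tc := tc) (R := R) hV e
  have hs1 : 1 ≤ P.s := by have := hV.toValid.facts.1; have := hV.toValid.facts.2.2.2.2.1; omega
  have hC := C_ok (tc := tc) (R := R) hV hD e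
  have hXe := X_ok (tc := tc) (R := R) hV hD (R.tip e) e
  have hXb := X_ok (tc := tc) (R := R) hV hD (R.tip b) e
  have hYe := Y_ok (D := D) (R := R) hV htc e e
  have hYb := Y_ok (D := D) (R := R) hV htc b e
  have cXe := X_cut (R := R) hV hD (R.tip e)
  have cXb := X_cut (R := R) hV hD (R.tip b)
  have cYe := Y_cut (D := D) (R := R) hV htc htgt e
  have cYb := Y_cut (D := D) (R := R) hV htc htgt b
  have kC : frKey P.Mstar (C P D R).fr (C P D R).lo = R.c := key_C hD hR
  have ρX : ∀ a, (X P D a).lo ≤ D.ξ P a ∧ D.ξ P a ≤ (X P D a).hi := fun a => ⟨le_rfl, le_rfl⟩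
  have ρY : ∀ e', (Y P tc e').lo ≤ t P tc e' ∧ t P tc e' ≤ (Y P tc e').hi := fun e' =>
    ⟨le_rfl, by show t P tc e' ≤ t P tc e' + _; exact le_add_of_nonneg_right (by positivity)⟩
  have kP : ∀ a, frKey P.Mstar (X P D a).fr (D.ξ P a) < 12 * P.Mstar := fun a => by
    have := (hD.κ_range hV a).2; have := hV.rfacts.2.1; have := hV.rfacts.1
    show D.κ P a < _; linarith
  have gP : ∀ e', frKey P.Mstar (Y P tc e').fr (t P tc e') < 12 * P.Mstar := fun e' => by
    obtain ⟨-, -, -, -, -, -, -, g2, hts⟩ := tgt_facts hV htc e'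
    have hM : (0 : ℤ) ≤ P.Mstar := by positivity
    have h6 : (Slot4.ts e' : ℤ) ≤ 5 := by omega
    have := hV.rfacts.2.1; have := hV.rfacts.1
    show γ P tc e' < _; nlinarith
  have wXb := fun p (hp : (X P D (R.tip b)).wlo (nE P D tc R e) P.s (rE P D tc R e) ≤ p ∧ p ≤ (X P D (R.tip b)).whi (nE P D tc R e) P.s (rE P D tc R e)) =>
    RingObj.linPos_window (n := nE P D tc R e) hXb hC hs1 hns cXb hp
  have wYb := fun p (hp : (Y P tc b).wlo (nE P D tc R e) P.s (rE P D tc R e) ≤ p ∧ p ≤ (Y P tc b).whi (nE P D tc R e) P.s (rE P D tc R e)) =>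
    RingObj.linPos_window (n := nE P D tc R e) hYb hC hs1 hns cYb hp
  -- the generic step
  have step := fun {A B : RingObj} (hA : A.OK P.s (rE P D tc R e) P.Mstar) (hB : B.OK P.s (rE P D tc R e) P.Mstar)
      (hsep : RingObj.Sep P.s A B) (cA : RingObj.Before 2 P.s A (C P D R) ∨ RingObj.Before 2 P.s (C P D R) A)
      (cB : RingObj.Before 2 P.s B (C P D R) ∨ RingObj.Before 2 P.s (C P D R) B) {ρA ρB : ℤ}
      (hρA : A.lo ≤ ρA ∧ ρA ≤ A.hi) (hρB : B.lo ≤ ρB ∧ ρB ≤ B.hi) (hPB : frKey P.Mstar B.fr ρB < 12 * P.Mstar)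
      (hlt : cyc (12 * P.Mstar) R.c (frKey P.Mstar A.fr ρA) < cyc (12 * P.Mstar) R.c (frKey P.Mstar B.fr ρB)) =>
    RingObj.linPos_lt_of_cyc_lt (n := nE P D tc R e) hA hB hC hs1 hns hsep cA cB hρA hρB hPB (by rw [kC]; exact hlt)
  unfold lp hs he GE LParams.iGr
  unfold nE at wXb wYb ⊢
  constructor
  · intro hl p hp1 hp2
    have w := wXb p ⟨hp1, hp2⟩
    rcases l1 hl with h | h
    · left
      obtain ⟨h1, h2⟩ := lt_min_iff.1 h
      have w1 := step hXb hXe (sep_XX hV hD (Ne.symm htt)) cXb cXe (ρX _) (ρX _) (kP _) h1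
      have w2 := step hXb hYe (sep_XY hV htc htgt _ _) cXb cYe (ρX _) (ρY _) (gP _) h2
      exact lt_of_le_of_lt w.2 (lt_min w1 w2)
    · right
      obtain ⟨h1, h2⟩ := max_lt_iff.1 h
      have w1 := step hXe hXb (sep_XX hV hD htt) cXe cXb (ρX _) (ρX _) (kP _) h1
      have w2 := step hYe hXb (TipData.sep_symm (sep_XY hV htc htgt _ _)) cYe cXb (ρY _) (ρX _) (kP _) h2
      exact lt_of_lt_of_le (max_lt w1 w2) w.1
  · intro hl p hp1 hp2
    have w := wYb p ⟨hp1, hp2⟩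
    rcases l2 hl with h | h
    · left
      obtain ⟨h1, h2⟩ := lt_min_iff.1 h
      have w1 := step hYb hXe (TipData.sep_symm (sep_XY hV htc htgt _ _)) cYb cXe (ρY _) (ρX _) (kP _) h1
      have w2 := step hYb hYe (sep_YY (Ne.symm heb)) cYb cYe (ρY _) (ρY _) (gP _) h2
      exact lt_of_le_of_lt w.2 (lt_min w1 w2)
    · right
      obtain ⟨h1, h2⟩ := max_lt_iff.1 h
      have w1 := step hXe hYb (sep_XY hV htc htgt _ _) cXe cYb (ρX _) (ρY _) (gP _) h1
      have w2 := step hYe hYb (sep_YY heb) cYe cYb (ρY _) (ρY _) (gP _) h2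
      exact lt_of_lt_of_le (max_lt w1 w2) w.1


/-! ### The routed slot -/

section SlotFields

variable (P D tc R)

/-- Field of the routed slot. [folklore] -/
theorem slot_fr (e : Fin 4) : (slot P D tc R).fr e = D.i (R.tip e) := rfl
/-- Field of the routed slot. [folklore] -/
theorem slot_lv (e : Fin 4) : (slot P D tc R).lv e = lv P D tc R e := rfl
/-- Field of the routed slot. [folklore] -/
theorem slot_ast (e : Fin 4) : (slot P D tc R).ast e = astE P D tc R e := rfl
/-- Field of the routed slot. [folklore] -/
theorem slot_aln (e : Fin 4) : (slot P D tc R).aln e = alnE P D tc R e := rfl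
/-- Field of the routed slot. [folklore] -/
theorem slot_k (e : Fin 4) : (slot P D tc R).k P e = D.k P (R.tip e) := rfl
/-- Field of the routed slot. [folklore] -/
theorem slot_T (e : Fin 4) : (slot P D tc R).T P e = D.T P (R.tip e) := rfl
/-- Field of the routed slot. [folklore] -/
theorem slot_ξ (e : Fin 4) : (slot P D tc R).ξ P e = D.ξ P (R.tip e) := rfl
/-- Field of the routed slot. [folklore] -/
theorem slot_t (e : Fin 4) : (slot P D tc R).t P e = t P tc e := rfl
/-- Field of the routed slot. [folklore] -/
theorem slot_nr (e : Fin 4) : (slot P D tc R).nr P e = nE P D tc R e := rfl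
/-- Field of the routed slot. [folklore] -/
theorem slot_r (e : Fin 4) : (slot P D tc R).r P e = rE P D tc R e := rfl
/-- Field of the routed slot. [folklore] -/
theorem slot_G (e : Fin 4) : (slot P D tc R).G P e = GE P D tc R e := rfl
/-- Field of the routed slot. [folklore] -/
theorem slot_toView (e : Fin 4) (p : ℕ) :
    (slot P D tc R).toView P e p = (p + GE P D tc R e - shE P D tc R e) % GE P D tc R e := rfl
/-- Field of the routed slot. [folklore] -/
theorem slot_runLo (e : Fin 4) : (slot P D tc R).runLo P e =
    min (piecePos (nE P D tc R e) (Slot4.bs e) (latIdx P.s (rE P D tc R e) (t P tc e)))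
      (piecePos (nE P D tc R e) (Slot4.bs e) (latIdx P.s (rE P D tc R e) (t P tc e) + P.d)) := rfl
/-- Field of the routed slot. [folklore] -/
theorem slot_runHi (e : Fin 4) : (slot P D tc R).runHi P e =
    max (piecePos (nE P D tc R e) (Slot4.bs e) (latIdx P.s (rE P D tc R e) (t P tc e)))
      (piecePos (nE P D tc R e) (Slot4.bs e) (latIdx P.s (rE P D tc R e) (t P tc e) + P.d)) := rfl
/-- Field of the routed slot. [folklore] -/
theorem slot_spokeWinLo (b e : Fin 4) : (slot P D tc R).spokeWinLo P b e =
    blockOff (nE P D tc R e) (D.i (R.tip b)) +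
      (if D.i (R.tip b) % 3 = 2 then 2 * (nE P D tc R e - 2 - latIdx P.s (rE P D tc R e) (D.ξ P (R.tip b)))
        else 2 * (latIdx P.s (rE P D tc R e) (D.ξ P (R.tip b)) - 1)) := rfl
/-- Field of the routed slot. [folklore] -/
theorem slot_apprWinLo (b e : Fin 4) : (slot P D tc R).apprWinLo P b e =
    min (piecePos (nE P D tc R e) (Slot4.ts b) (latIdx P.s (rE P D tc R e) (t P tc b) - 1))
      (piecePos (nE P D tc R e) (Slot4.ts b) (latIdx P.s (rE P D tc R e) (t P tc b + (P.n / 64 : ℕ)) + 1)) := rfl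
/-- Field of the routed slot. [folklore] -/
theorem slot_apprWinHi (b e : Fin 4) : (slot P D tc R).apprWinHi P b e =
    max (piecePos (nE P D tc R e) (Slot4.ts b) (latIdx P.s (rE P D tc R e) (t P tc b) - 1))
      (piecePos (nE P D tc R e) (Slot4.ts b) (latIdx P.s (rE P D tc R e) (t P tc b + (P.n / 64 : ℕ)) + 1)) + 1 := rfl
/-- Field of the routed slot. [folklore] -/
theorem slot_pE (e : Fin 4) : (slot P D tc R).pE P e =
    piecePos (nE P D tc R e) (if 2 ≤ (e : ℕ) then (D.i (R.tip e) + 3) % 6 else D.i (R.tip e))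
      (latIdx P.s (rE P D tc R e) (D.ξ P (R.tip e))) := rfl

end SlotFields

/-- The entry piece of the routed slot is the piece of the spoke row, seen in the reading configuration. [folklore] -/
theorem pE_eq (hV : P.RValid) (hD : D.Good P) (e : Fin 4) :
    (slot P D tc R).pE P e = ((X P D (R.tip e)).cutPos (nE P D tc R e) P.s (rE P D tc R e) + GE P D tc R e - shE P D tc R e) % GE P D tc R e := by
  obtain ⟨hn1, hns, -, hG, -⟩ := ringE_facts (D := D) (tc := tc) (R := R) hV e
  have hs1 : 1 ≤ P.s := by have := hV.toValid.facts.1; have := hV.toValid.facts.2.2.2.2.1; omega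
  have hX := X_ok (tc := tc) (R := R) hV hD (R.tip e) e
  obtain ⟨-, -, x3⟩ := hX.idx hs1 hns
  have hι : latIdx P.s (rE P D tc R e) (D.ξ P (R.tip e)) < nE P D tc R e := by
    change latIdx P.s (rE P D tc R e) (D.ξ P (R.tip e)) + 4 < nE P D tc R e at x3; omega
  rw [slot_pE]
  show _ = (piecePos (nE P D tc R e) (D.i (R.tip e)) (latIdx P.s (rE P D tc R e) (D.ξ P (R.tip e))) + GE P D tc R e - shE P D tc R e) % GE P D tc R e
  unfold shE
  by_cases h2 : 2 ≤ (e : ℕ)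
  · rw [if_pos h2, if_pos h2, hG]
    exact piecePos_frame_add_three hn1 (hD.hi _) hι
  · rw [if_neg h2, if_neg h2, Nat.sub_zero, Nat.add_mod_right, Nat.mod_eq_of_lt]
    rw [hG]; exact piecePos_lt hn1 (hD.hi _) hι

/-- **The routed slot satisfies the routing predicate.** [cite: Nolin2008, §4.3 Prop. 12 (i), Lemma 13 and §4.4 p. 12 (arXiv 0711.4948: Prop. 11, Lemma 12; proof of Thm. 10)] -/
theorem routeOK_slot (hV : P.RValid) (hD : D.Good P) (htc : ∀ e, tc e < 5) (htgt : D.TgtOK P tc) (hR : RouteGood P D tc R) :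
    InSlot4.RouteOK P (slot P D tc R) := by
  have hs1 : 1 ≤ P.s := by have := hV.toValid.facts.1; have := hV.toValid.facts.2.2.2.2.1; omega
  have HF := fun e => hull_facts (tc := tc) (R := R) hV hD e
  have RF := fun e => ringE_facts (D := D) (tc := tc) (R := R) hV e
  have shG : ∀ e, shE P D tc R e ≤ GE P D tc R e := fun e => by
    obtain ⟨hn1, -, -, hG, -⟩ := RF e; unfold shE; rw [hG]; split_ifs <;> omega
  have hAG : ∀ e, astAbs P D tc R e < GE P D tc R e := fun e => by
    obtain ⟨hpcG, -⟩ := HF e; unfold astAbs; exact Nat.mod_lt _ (by omega)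
  -- membership in the hull arc, from a read position
  have memArc : ∀ e p, p < GE P D tc R e → hs P D tc R e ≤ lp P D tc R e p → lp P D tc R e p ≤ he P D tc R e →
      InArc (GE P D tc R e) (astE P D tc R e) (alnE P D tc R e) ((p + GE P D tc R e - shE P D tc R e) % GE P D tc R e) := by
    intro e p hpG h1 h2
    obtain ⟨hpcG, hshe, hheG, -⟩ := HF e
    unfold astE
    rw [inArc_rot (hAG e) hpG (shG e)]
    unfold astAbs alnE
    rw [inArc_hull_iff hpcG hpG hshe hheG]
    exact ⟨h1, h2⟩
  have notMemArc : ∀ e p, p < GE P D tc R e → (lp P D tc R e p < hs P D tc R e ∨ he P D tc R e < lp P D tc R e p) →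
      ¬ InArc (GE P D tc R e) (astE P D tc R e) (alnE P D tc R e) ((p + GE P D tc R e - shE P D tc R e) % GE P D tc R e) := by
    intro e p hpG h
    obtain ⟨hpcG, hshe, hheG, -⟩ := HF e
    unfold astE
    rw [inArc_rot (hAG e) hpG (shG e)]
    unfold astAbs alnE
    rw [inArc_hull_iff hpcG hpG hshe hheG]
    unfold lp at h
    omega
  unfold InSlot4.RouteOK
  simp only [slot_ast, slot_aln, slot_G, slot_lv, slot_runLo, slot_runHi, slot_toView, slot_spokeWinLo, slot_apprWinLo,
    slot_apprWinHi, slot_nr, slot_fr, slot_ξ, slot_t, slot_T, slot_k, pE_eq hV hD]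
  refine ⟨fun e => ?_, fun e b heb h => R.q_ne heb (laneLevel_injective _ _ h), fun e => ?_, fun e p hpG hlo hhi => ?_,
    fun e b hcol hl q₀ hq₀ => ?_, fun e b hcol hl p hp12 hlo hhi => ?_, fun e b _ hfr => htgt.out b (R.tip e) hfr, fun e b hcol hfr => ?_⟩
  · -- (a) the arc is a genuine arc of the ring
    obtain ⟨hpcG, hshe, hheG, -⟩ := HF e
    have hGpos : 0 < GE P D tc R e := by omega
    unfold astE alnE
    exact ⟨Nat.mod_lt _ hGpos, by omega, by omega⟩
  · -- (c) the entry piece is on the arc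
    obtain ⟨hn1, hns, -, hG, -⟩ := RF e
    obtain ⟨-, -, -, h1, h2, -, -⟩ := HF e
    have hX := X_ok (tc := tc) (R := R) hV hD (R.tip e) e
    have hC := C_ok (tc := tc) (R := R) hV hD e
    have pXw := RingObj.wlo_le_cutPos (n := nE P D tc R e) hX hs1 hns
    obtain ⟨-, -, bx, ex⟩ := RingObj.window_mem_block (n := nE P D tc R e) hX hs1 hns
    have w := RingObj.linPos_window (n := nE P D tc R e) hX hC hs1 hns (X_cut (R := R) hV hD (R.tip e)) ⟨pXw.1, by omega⟩
    refine memArc e _ (by rw [hG]; omega) ?_ ?_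
    · unfold lp GE LParams.iGr pc; unfold lp GE LParams.iGr pc at h1; unfold nE at w h1 ⊢; exact h1.trans w.1
    · unfold lp GE LParams.iGr pc; unfold lp GE LParams.iGr pc at h2; unfold nE at w h2 ⊢; exact w.2.trans h2
  · -- (d) the exit run is on the arc
    obtain ⟨hn1, hns, -, hG, -⟩ := RF e
    obtain ⟨-, -, -, -, -, h3, h4⟩ := HF e
    have hY := Y_ok (D := D) (R := R) hV htc e e
    have hC := C_ok (tc := tc) (R := R) hV hD e
    obtain ⟨y1, y2, y3⟩ := hY.idx hs1 hns
    obtain ⟨-, -, byy, ey⟩ := RingObj.window_mem_block (n := nE P D tc R e) hY hs1 hns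
    have hlo' : -(rE P D tc R e : ℤ) ≤ t P tc e := by
      have h := hY.hlo; have hMr : (2 * P.Mstar : ℤ) ≤ rE P D tc R e := by exact_mod_cast hY.hMr
      change _ ≤ t P tc e at h; have : (0 : ℤ) ≤ P.s := by positivity
      linarith
    have hhi_idx : latIdx P.s (rE P D tc R e) (Y P tc e).hi = latIdx P.s (rE P D tc R e) (t P tc e) + (P.d - 1) :=
      latIdx_row_add_mul hs1 hlo' (P.d - 1)
    have hd1 : 1 ≤ P.d := by unfold LParams.d; generalize P.n / 64 / P.s = x; omega
    change 2 ≤ latIdx P.s (rE P D tc R e) (t P tc e) at y1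
    change latIdx P.s (rE P D tc R e) (t P tc e) ≤ _ at y2
    rw [hhi_idx] at y3
    have wa := RingObj.piecePos_mem_window (n := nE P D tc R e) hY hs1 hns (ι := latIdx P.s (rE P D tc R e) (t P tc e))
      (by change latIdx _ _ (t P tc e) - 1 ≤ _; omega) (by rw [hhi_idx]; omega)
    have wb := RingObj.piecePos_mem_window (n := nE P D tc R e) hY hs1 hns (ι := latIdx P.s (rE P D tc R e) (t P tc e) + P.d)
      (by change latIdx _ _ (t P tc e) - 1 ≤ _; omega) (by rw [hhi_idx]; omega)
    have ea := piecePos_ts e hn1 (ι := latIdx P.s (rE P D tc R e) (t P tc e)) (by omega)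
    have eb := piecePos_ts e hn1 (ι := latIdx P.s (rE P D tc R e) (t P tc e) + P.d) (by omega)
    have esh : shE P D tc R e = (if 2 ≤ (e : ℕ) then 6 * nE P D tc R e - 2 else 0) := rfl
    rw [← esh] at ea eb
    change (Y P tc e).wlo (nE P D tc R e) P.s (rE P D tc R e) ≤ piecePos (nE P D tc R e) (Slot4.ts e) _ ∧
      piecePos (nE P D tc R e) (Slot4.ts e) _ + 1 ≤ (Y P tc e).whi (nE P D tc R e) P.s (rE P D tc R e) at wa
    change (Y P tc e).wlo (nE P D tc R e) P.s (rE P D tc R e) ≤ piecePos (nE P D tc R e) (Slot4.ts e) _ ∧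
      piecePos (nE P D tc R e) (Slot4.ts e) _ + 1 ≤ (Y P tc e).whi (nE P D tc R e) P.s (rE P D tc R e) at wb
    rw [ea] at wa; rw [eb] at wb
    have hp' : (Y P tc e).wlo (nE P D tc R e) P.s (rE P D tc R e) ≤ p + shE P D tc R e ∧
        p + shE P D tc R e ≤ (Y P tc e).whi (nE P D tc R e) P.s (rE P D tc R e) := by
      constructor <;> omega
    have hp'G : p + shE P D tc R e < GE P D tc R e := by rw [hG]; omega
    have w := RingObj.linPos_window (n := nE P D tc R e) hY hC hs1 hns (Y_cut (D := D) (R := R) hV htc htgt e) hp'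
    have key : p = (p + shE P D tc R e + GE P D tc R e - shE P D tc R e) % GE P D tc R e := by
      rw [show p + shE P D tc R e + GE P D tc R e - shE P D tc R e = p + GE P D tc R e by omega, Nat.add_mod_right,
        Nat.mod_eq_of_lt hpG]
    rw [key]
    refine memArc e _ hp'G ?_ ?_
    · unfold lp GE LParams.iGr pc; unfold lp GE LParams.iGr pc at h3; unfold nE at w h3 ⊢; exact h3.trans w.1
    · unfold lp GE LParams.iGr pc; unfold lp GE LParams.iGr pc at h4; unfold nE at w h4 ⊢; exact w.2.trans h4
  · -- (e) the spoke windows of the other colour, higher rings, are off the arc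
    obtain ⟨hn1, hns, -, hG, -⟩ := RF e
    have hXb := X_ok (tc := tc) (R := R) hV hD (R.tip b) e
    obtain ⟨x1, -, x3⟩ := hXb.idx hs1 hns
    obtain ⟨-, -, bx, ex⟩ := RingObj.window_mem_block (n := nE P D tc R e) hXb hs1 hns
    change 2 ≤ latIdx P.s (rE P D tc R e) (D.ξ P (R.tip b)) at x1
    change latIdx P.s (rE P D tc R e) (D.ξ P (R.tip b)) + 4 < nE P D tc R e at x3
    set ι := latIdx P.s (rE P D tc R e) (D.ξ P (R.tip b)) with hι
    set p := blockOff (nE P D tc R e) (D.i (R.tip b)) +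
        (if D.i (R.tip b) % 3 = 2 then 2 * (nE P D tc R e - 2 - ι) else 2 * (ι - 1)) + q₀ with hp_def
    have hpw : (X P D (R.tip b)).wlo (nE P D tc R e) P.s (rE P D tc R e) ≤ p ∧ p ≤ (X P D (R.tip b)).whi (nE P D tc R e) P.s (rE P D tc R e) := by
      unfold RingObj.wlo RingObj.whi
      change min (piecePos (nE P D tc R e) (D.i (R.tip b)) (ι - 1)) (piecePos (nE P D tc R e) (D.i (R.tip b)) (ι + 1)) ≤ p ∧
        p ≤ max (piecePos (nE P D tc R e) (D.i (R.tip b)) (ι - 1)) (piecePos (nE P D tc R e) (D.i (R.tip b)) (ι + 1)) + 1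
      by_cases h2 : D.i (R.tip b) % 3 = 2
      · rw [if_pos h2] at hp_def; rw [piecePos_eq_of_two h2, piecePos_eq_of_two h2]; constructor <;> omega
      · rw [if_neg h2] at hp_def; rw [piecePos_eq_of_ne h2, piecePos_eq_of_ne h2]; constructor <;> omega
    have hpG : p < GE P D tc R e := by rw [hG]; omega
    exact notMemArc e p hpG ((excl hV hD htc htgt hR hcol).1 hl p hpw.1 hpw.2)
  · -- (f) the approach windows of the other colour, lower rings, are off the arc
    obtain ⟨hn1, hns, -, hG, -⟩ := RF e
    have hYb := Y_ok (D := D) (R := R) hV htc b e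
    obtain ⟨y1, y2, y3⟩ := hYb.idx hs1 hns
    obtain ⟨-, -, byy, ey⟩ := RingObj.window_mem_block (n := nE P D tc R e) hYb hs1 hns
    obtain ⟨-, -, hd1, -⟩ := tgt_facts hV htc b
    have hm1 : latIdx P.s (rE P D tc R e) (t P tc b) ≤ latIdx P.s (rE P D tc R e) (t P tc b + (P.n / 64 : ℕ)) :=
      latIdx_mono (by have : (0 : ℤ) ≤ ((P.n / 64 : ℕ) : ℤ) := by positivity
                      linarith)
    have hm2 : latIdx P.s (rE P D tc R e) (t P tc b + (P.n / 64 : ℕ)) ≤ latIdx P.s (rE P D tc R e) (Y P tc b).hi :=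
      latIdx_mono (by change _ ≤ t P tc b + _; linarith)
    change 2 ≤ latIdx P.s (rE P D tc R e) (t P tc b) at y1
    change latIdx P.s (rE P D tc R e) (t P tc b) ≤ _ at y2
    have wa := RingObj.piecePos_mem_window (n := nE P D tc R e) hYb hs1 hns (ι := latIdx P.s (rE P D tc R e) (t P tc b) - 1) le_rfl (by omega)
    have wb := RingObj.piecePos_mem_window (n := nE P D tc R e) hYb hs1 hns (ι := latIdx P.s (rE P D tc R e) (t P tc b + (P.n / 64 : ℕ)) + 1)
      (by change latIdx _ _ (t P tc b) - 1 ≤ _; omega) (by omega)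
    change (Y P tc b).wlo (nE P D tc R e) P.s (rE P D tc R e) ≤ piecePos (nE P D tc R e) (Slot4.ts b) _ ∧
      piecePos (nE P D tc R e) (Slot4.ts b) _ + 1 ≤ (Y P tc b).whi (nE P D tc R e) P.s (rE P D tc R e) at wa
    change (Y P tc b).wlo (nE P D tc R e) P.s (rE P D tc R e) ≤ piecePos (nE P D tc R e) (Slot4.ts b) _ ∧
      piecePos (nE P D tc R e) (Slot4.ts b) _ + 1 ≤ (Y P tc b).whi (nE P D tc R e) P.s (rE P D tc R e) at wb
    have hpw : (Y P tc b).wlo (nE P D tc R e) P.s (rE P D tc R e) ≤ p ∧ p ≤ (Y P tc b).whi (nE P D tc R e) P.s (rE P D tc R e) := by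
      constructor <;> omega
    have hpG : p < GE P D tc R e := by rw [hG]; omega
    exact notMemArc e p hpG ((excl hV hD htc htgt hR hcol).2 hl p hpw.1 hpw.2)
  · -- (h) tips of different colours on a common frame
    have hpar := hR.tip_parity_ne hcol
    rcases lt_trichotomy (D.ζ (R.tip e)) (D.ζ (R.tip b)) with h | h | h
    · exact Or.inl (hD.gap_of_diff hV hpar hfr h).2
    · exact absurd h (hD.zeta_ne hV (R.tip_ne (fun h' => hcol (h' ▸ rfl))) hfr)
    · exact Or.inr (hD.gap_of_diff hV (Ne.symm hpar) hfr.symm h).2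

/-- **The routed slot is one of the finitely many slots.** [folklore] -/
theorem slot_mem_inSlot4Finset (hV : P.RValid) (hD : D.Good P) (htc : ∀ e, tc e < 5) :
    slot P D tc R ∈ inSlot4Finset P := by
  rw [mem_inSlot4Finset]
  intro q e
  obtain ⟨hpcG, hshe, hheG, -⟩ := hull_facts (tc := tc) (R := R) hV hD e
  obtain ⟨hn1, -, -, hG, hn7, hlv⟩ := ringE_facts (D := D) (tc := tc) (R := R) hV e
  have hGpos : 0 < GE P D tc R e := by omega
  have hG7 : GE P D tc R e ≤ P.iGr 0 := by rw [hG]; unfold LParams.iGr; omega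
  fin_cases q
  · exact hD.hi _
  · exact hD.hj _
  · exact hD.hν _
  · exact htc e
  · exact hlv
  · show astE P D tc R e < P.iGr 0 + 1
    have : astE P D tc R e < GE P D tc R e := Nat.mod_lt _ hGpos
    omega
  · show alnE P D tc R e < P.iGr 0 + 1
    unfold alnE; omega


end ITipData

end Literature.Probability.Percolation
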